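import Summits.BirchSwinnertonDyer.Rank1Residual.X11b.CoinducedShiftExact
import Summits.BirchSwinnertonDyer.Rank1Residual.X11b.LocSurjFromLevels
import Summits.BirchSwinnertonDyer.Rank1Residual.X11b.AnticyclotomicGoodPlaces
import HarnessLib

/-!
# X11b, route R1 — atom (L10), local step: restriction to `ker κ ∩ D_v` inside a decomposition
# group, its naturality, the away condition, vanishing on inertia, and the bridge to `H¹(K_v, M)`

HONEST FRAMING (cell `b2b-bsdres`, run/shared/lean/b2b/bsd-rank1-residual/, verbatim in every
file): the goal of the cell is to DELETE the COMBINATION-SHAPED residual classes of the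
Birch–Swinnerton-Dyer formula for ALL analytic-rank `≤ 1` elliptic curves over `ℚ` — "full BSD
formula for every rank `≤ 1` curve in class `C`" assembled STRICTLY from published theorems — so
that the rank-`≤ 1` remainder becomes exactly the CONSTRUCTION-SHAPED classes, which are TYPED
(missing-input `Prop`s), NOT attempted. This is not "finishing BSD". Sub-cell
`b2b-bsdres-multr1-p1` (X11b, route R1 = Castella 2018 Thm. A re-proved along the author's
erratum); a RESEARCH ROUTE; no claim beyond the stated class; X11b stays CONSTRUCTION-SHAPED;
nothing here changes a label; no named fact is minted (auxiliary definitions with bodies — group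
homomorphisms — and theorems; no `sorry`).

## What this file does (JSW17 Lemma 3.3.3, second half, local bookkeeping)

For a `ℤ_p`-extension `κ` of a number field `K` (`H = ker κ`), a discrete `Γ_K`-module `M` with
open stabilisers and a finite place `v` with decomposition group `D_v = GreenbergSelmer.decomp v`:

* `kappaD κ v = κ|_{D_v} : D_v →ₜ* ℤ_p`; `kerD κ v = ker(κ|_{D_v}) ≤ D_v` (`= H ∩ D_v` seen in
  `D_v`);
* `resKerD κ v : H¹(H, M) → H¹(H ∩ D_v, M)` (restriction along `ker(κ|_{D_v}) ↪ H`), with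
  `mem_awayKer_iff_resKerD_eq_zero` (the AWAY / STRICT-at-`𝔭` condition of Castella's Selmer group
  IS `resKerD = 0`), `resKerD_conjH1` (naturality with `conj_d`, `d ∈ D_v`) and
  `resKerD_resSubgroup` (compatibility with restriction from `Γ_K` through `D_v`);
* `resOfLe_eq_zero_of_resSubgroup_kerD_eq` — a class `z ∈ H¹(D_v, M)` whose restriction to
  `H ∩ D_v` is `resKerD y₀` dies on any `I ≤ H ∩ D_v` on which `y₀` dies; with gen 11's
  `resOfLe_inertia_injective_of_hasGoodReductionAt` this kills `z` at the good places `v ∤ p` where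
  the cocycle of `y₀` vanishes on inertia (`resOfLe_oneCocycleClass_eq_zero_of_forall`);
* `inflDecomp hM v : H¹(D_v, M) ↪ H¹(K_v, M)` (gen 14's inflation, from `D_v`), injective, with
  `inflDecomp (res_{D_v} c) = loc_v c`.

References: [JetchevSkinnerWan2017] Lemma 3.3.3 (arXiv:1512.06894 pp. 11–12);
[GreenbergLNM1716] §2–3; [SerreGaloisCohomology1997] I §2.4–2.6.
-/

noncomputable section

open scoped Classical

open CategoryTheory Function Field NumberField IsDedekindDomain
open Literature.NumberTheory.GaloisRepresentations Literature.NumberTheory.EllipticCurves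
open Literature.NumberTheory.EllipticCurves.GreenbergSelmer

universe u

namespace Summit.BirchSwinnertonDyer.Rank1Residual.X11b.Coinv

open Summit.BirchSwinnertonDyer.Rank1Residual.X11b.ProcyclicDescent (kerK)
open Summit.BirchSwinnertonDyer.Rank1Residual.X11b.LocBridge

/-! ## §1. `κ|_{D_v}`, its kernel, and the restriction `H¹(H, M) → H¹(H ∩ D_v, M)` -/

section Local

variable {K : Type u} [Field K] [NumberField K] {p : ℕ} [Fact p.Prime] (κ : ZpExtension K p)
variable {M : Type u} [AddCommGroup M] [DistribMulAction (absoluteGaloisGroup K) M]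
  [TopologicalSpace M] [DiscreteTopology M]

/-- `κ|_{D_v} : D_v →ₜ* ℤ_p`, the anticyclotomic character on a decomposition group. A definition;
nothing asserted. [cite: JetchevSkinnerWan2017, Lemma 3.3.3 (arXiv:1512.06894 p. 12)] -/
def kappaD (v : HeightOneSpectrum (𝓞 K)) :
    (decomp v : Subgroup (absoluteGaloisGroup K)) →ₜ* Multiplicative ℤ_[p] :=
  κ.toContinuousMonoidHom.comp (Literature.NumberTheory.EllipticCurves.subgroupIncl (decomp v))

/-- Unfolding `kappaD`. [folklore] -/
@[simp]
theorem kappaD_apply (v : HeightOneSpectrum (𝓞 K)) (d : decomp (K := K) v) :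
    kappaD κ v d = κ (d : absoluteGaloisGroup K) :=
  rfl

/-- `ker(κ|_{D_v}) ≤ D_v` — the decomposition group `H ∩ D_v` of `K_∞ = K̄^H` at the chosen place
above `v`, as a subgroup of `D_v`. [cite: Greenberg1989, §1 p. 98] -/
abbrev kerD (v : HeightOneSpectrum (𝓞 K)) : Subgroup (decomp (K := K) v) :=
  kerK (kappaD κ v)

/-- Membership in `kerD`: `d ∈ ker κ`. [folklore] -/
theorem mem_kerD_iff (v : HeightOneSpectrum (𝓞 K)) (d : decomp (K := K) v) :
    d ∈ kerD κ v ↔ (d : absoluteGaloisGroup K) ∈ κ.kerSubgroup := by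
  rw [kerD, MonoidHom.mem_ker, ZpExtension.mem_kerSubgroup]
  rfl

/-- The inclusion `ker(κ|_{D_v}) ↪ H = ker κ`. [folklore] -/
def kerDIncl (v : HeightOneSpectrum (𝓞 K)) : kerD κ v →ₜ* κ.kerSubgroup where
  toFun x := ⟨((x : decomp (K := K) v) : absoluteGaloisGroup K), (mem_kerD_iff κ v _).1 x.2⟩
  map_one' := rfl
  map_mul' _ _ := rfl
  continuous_toFun := (continuous_subtype_val.comp continuous_subtype_val).subtype_mk _

/-- Unfolding `kerDIncl`. [folklore] -/
@[simp]
theorem coe_kerDIncl (v : HeightOneSpectrum (𝓞 K)) (x : kerD κ v) :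
    ((kerDIncl κ v x : κ.kerSubgroup) : absoluteGaloisGroup K) = ((x : decomp (K := K) v) : _) :=
  rfl

variable (M) in
/-- **`resKerD : H¹(H, M) → H¹(H ∩ D_v, M)`** — restriction of classes of `K_∞ = K̄^H` to the
decomposition group of the chosen place above `v` (seen inside `D_v`). A definition; nothing
asserted. [cite: Greenberg1989, §1 p. 98 (3)] -/
def resKerD (v : HeightOneSpectrum (𝓞 K)) : subgroupH1 κ.kerSubgroup M →+ subgroupH1 (kerD κ v) M :=
  resH1Hom (kerDIncl κ v) (AddMonoidHom.id M) fun _ _ ↦ rfl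

/-- **The away condition is `resKerD = 0`**: `c ∈ awayKer H M v ↔ resKerD c = 0` (both are kernels
of restrictions along maps into `H` with the same range `H ∩ D_v`,
`resH1Hom_eq_zero_iff_of_range_eq`). [cite: Greenberg1989, §1 p. 98 (3)]
[cite: Castella2018, Def. 2.2 (arXiv:1704.06608 p. 5)] -/
theorem mem_awayKer_iff_resKerD_eq_zero (v : HeightOneSpectrum (𝓞 K))
    (c : subgroupH1 κ.kerSubgroup M) : c ∈ awayKer κ.kerSubgroup M v ↔ resKerD κ M v c = 0 := by
  rw [awayKer, AddMonoidHom.mem_ker, resOfLe, resKerD]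
  refine resH1Hom_eq_zero_iff_of_range_eq _ _ _ Function.bijective_id _ _ _
    Function.bijective_id ?_ _
  ext h
  constructor
  · rintro ⟨x, rfl⟩
    have hx := Subgroup.mem_inf.mp x.2
    exact ⟨⟨⟨(x : absoluteGaloisGroup K), hx.2⟩, (mem_kerD_iff κ v _).2 hx.1⟩, rfl⟩
  · rintro ⟨x, rfl⟩
    exact ⟨⟨((x : decomp (K := K) v) : absoluteGaloisGroup K),
      Subgroup.mem_inf.mpr ⟨(mem_kerD_iff κ v _).1 x.2, (x : decomp (K := K) v).2⟩⟩, rfl⟩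

/-- **Naturality of `resKerD` with conjugation**: for `d ∈ D_v`,
`resKerD (conj_d c) = conj_d (resKerD c)` (both are induced by the pair
`(x ↦ d⁻¹ x d, m ↦ d • m)`). [cite: SerreGaloisCohomology1997, I §2.5] -/
theorem resKerD_conjH1 (v : HeightOneSpectrum (𝓞 K)) (d : decomp (K := K) v)
    (c : subgroupH1 κ.kerSubgroup M) :
    resKerD κ M v (conjH1 κ.kerSubgroup M (d : absoluteGaloisGroup K) c) =
      conjH1 (kerD κ v) M d (resKerD κ M v c) := by
  have e : (resKerD κ M v).comp (conjH1 κ.kerSubgroup M (d : absoluteGaloisGroup K)) =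
      (conjH1 (kerD κ v) M d).comp (resKerD κ M v) := by
    rw [resKerD, conjH1, conjH1, resH1Hom_comp, resH1Hom_comp]
    exact resH1Hom_congr (ContinuousMonoidHom.ext fun _ ↦ Subtype.ext rfl)
      (AddMonoidHom.ext fun _ ↦ rfl) _ _
  exact congrArg (fun f ↦ f c) e

/-- **`resKerD ∘ res_{Γ_K → H} = res_{D_v → H ∩ D_v} ∘ res_{Γ_K → D_v}`** (one restriction
`Γ_K → H ∩ D_v`). [cite: SerreGaloisCohomology1997, I §2.5] -/
theorem resKerD_resSubgroup (v : HeightOneSpectrum (𝓞 K))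
    (g : discreteH1 (absoluteGaloisGroup K) M) :
    resKerD κ M v (ResKernel.resSubgroup κ.kerSubgroup M g) =
      ResKernel.resSubgroup (kerD κ v) M (ResKernel.resSubgroup (decomp v) M g) := by
  have h := ResKernel.resH1Hom_comp_resSubgroup
    (Literature.NumberTheory.EllipticCurves.subgroupIncl (decomp (K := K) v)) (AddMonoidHom.id M)
    (fun _ _ ↦ rfl) κ.kerSubgroup (kerD κ v) (kerDIncl κ v) (fun _ ↦ rfl) (fun _ _ ↦ rfl)
  exact congrArg (fun f ↦ f g) h

/-! ## §2. Vanishing on a subgroup `I ≤ H ∩ D_v` -/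

/-- The inclusion `I ↪ ker(κ|_{D_v})` for `I ≤ D_v`, `I ≤ H`. [folklore] -/
def toKerD (v : HeightOneSpectrum (𝓞 K)) {I : Subgroup (absoluteGaloisGroup K)}
    (hID : I ≤ decomp v) (hIH : I ≤ κ.kerSubgroup) : I →ₜ* kerD κ v where
  toFun i := ⟨⟨(i : absoluteGaloisGroup K), hID i.2⟩, (mem_kerD_iff κ v _).2 (hIH i.2)⟩
  map_one' := rfl
  map_mul' _ _ := rfl
  continuous_toFun := (continuous_subtype_val.subtype_mk _).subtype_mk _

/-- **A class of `H¹(D_v, M)` restricting to `resKerD y₀` on `H ∩ D_v` dies on every `I ≤ H ∩ D_v`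
on which `y₀` dies** (functoriality of restriction). [cite: SerreGaloisCohomology1997, I §2.5] -/
theorem resOfLe_eq_zero_of_resSubgroup_kerD_eq (v : HeightOneSpectrum (𝓞 K))
    {I : Subgroup (absoluteGaloisGroup K)} (hID : I ≤ decomp v) (hIH : I ≤ κ.kerSubgroup)
    (y₀ : subgroupH1 κ.kerSubgroup M) (z : subgroupH1 (decomp (K := K) v) M)
    (hz : ResKernel.resSubgroup (kerD κ v) M z = resKerD κ M v y₀)
    (hy : resOfLe M hIH y₀ = 0) : resOfLe M hID z = 0 := by
  -- `res_{I ≤ D_v} = res_{I → ker(κ|D_v)} ∘ res_{D_v → ker(κ|D_v)}`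
  have e1 : resOfLe M hID = (resH1Hom (toKerD κ v hID hIH) (AddMonoidHom.id M) fun _ _ ↦ rfl).comp
      (ResKernel.resSubgroup (kerD κ v) M) := by
    rw [resOfLe, ResKernel.resSubgroup, resH1Hom_comp]
    exact resH1Hom_congr (ContinuousMonoidHom.ext fun _ ↦ rfl) (AddMonoidHom.ext fun _ ↦ rfl) _ _
  -- `res_{I → ker(κ|D_v)} ∘ resKerD = res_{I ≤ H}`
  have e2 : (resH1Hom (toKerD κ v hID hIH) (AddMonoidHom.id M) fun _ _ ↦ rfl).comp (resKerD κ M v) =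
      resOfLe M hIH := by
    rw [resOfLe, resKerD, resH1Hom_comp]
    exact resH1Hom_congr (ContinuousMonoidHom.ext fun _ ↦ rfl) (AddMonoidHom.ext fun _ ↦ rfl) _ _
  rw [e1, AddMonoidHom.comp_apply, hz, ← AddMonoidHom.comp_apply, e2, hy]

omit [NumberField K] in
/-- **A class dies on a subgroup where its cocycle vanishes**: if `φ(i) = 0` for all `i ∈ I ≤ H`
then `res_{I ≤ H} [φ] = 0`. [cite: SerreGaloisCohomology1997, I §2.4] -/
theorem resOfLe_oneCocycleClass_eq_zero_of_forall {H I : Subgroup (absoluteGaloisGroup K)}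
    (hIH : I ≤ H) (φ : contOneCocycles (discreteTopRep H M))
    (hφ : ∀ (i : absoluteGaloisGroup K) (hi : i ∈ I), φ.1 ⟨i, hIH hi⟩ = 0) :
    resOfLe M hIH (oneCocycleClass _ φ) = 0 := by
  rw [resOfLe, resH1Hom_oneCocycleClass']
  have h0 : contOneCocycles.pullback (subgroupInclusion hIH)
      (resHomOfEquivariant (subgroupInclusion hIH) (AddMonoidHom.id M) fun _ _ ↦ rfl) φ = 0 := by
    apply Subtype.ext
    ext i
    rw [contOneCocycles.pullback_apply]
    change φ.1 ⟨(i : absoluteGaloisGroup K), hIH i.2⟩ = 0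
    exact hφ i i.2
  rw [h0, oneCocycleClass_zero]

omit [NumberField K] in
/-- **The zero set of a cocycle of `H` contains `H ∩ N₁` for an open normal subgroup `N₁ ≤ Γ_K`**
(continuity of the cocycle, discreteness of `M`, profiniteness of `Γ_K`).
[cite: SerreGaloisCohomology1997, I §2.2] -/
theorem exists_openNormalSubgroup_forall_apply_eq_zero {H : Subgroup (absoluteGaloisGroup K)}
    (φ : contOneCocycles (discreteTopRep H M)) :
    ∃ N₁ : OpenNormalSubgroup (absoluteGaloisGroup K), ∀ (h : absoluteGaloisGroup K) (hh : h ∈ H),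
      h ∈ N₁ → φ.1 ⟨h, hh⟩ = 0 := by
  haveI : CompactSpace (absoluteGaloisGroup K) := absoluteGaloisGroup_compactSpace K
  have hz : IsOpen {h : H | φ.1 h = 0} := (isOpen_discrete ({0} : Set M)).preimage φ.1.continuous
  obtain ⟨U0, hU0, hU0eq⟩ := isOpen_induced_iff.mp hz
  have h1U0 : (1 : absoluteGaloisGroup K) ∈ U0 := by
    have : (1 : H) ∈ Subtype.val ⁻¹' U0 := by
      rw [hU0eq]
      exact contOneCocycles.apply_one φ
    exact this
  obtain ⟨N₁, hN₁⟩ := ProfiniteGrp.exist_openNormalSubgroup_sub_open_nhds_of_one hU0 h1U0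
  refine ⟨N₁, fun h hh hN ↦ ?_⟩
  have hmem : (⟨h, hh⟩ : H) ∈ Subtype.val ⁻¹' U0 := hN₁ hN
  rw [hU0eq] at hmem
  exact hmem

/-! ## §3. The bridge `H¹(D_v, M) ↪ H¹(K_v, M)` -/

variable (hM : ∀ m : M, IsOpen {σ : absoluteGaloisGroup K | σ • m = m})

variable (M) in
/-- `D_v ≤ ⊤ ⊓ D_v`. [folklore] -/
theorem decomp_le_top_inf (v : HeightOneSpectrum (𝓞 K)) :
    decomp (K := K) v ≤ (⊤ : Subgroup (absoluteGaloisGroup K)) ⊓ decomp v :=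
  fun g hg ↦ Subgroup.mem_inf.mpr ⟨Subgroup.mem_top g, hg⟩

/-- **`inflDecomp : H¹(D_v, M) → H¹(K_v, M) = H¹(Γ_{K_v}, M)`** — gen 14's inflation to the
completion, precomposed with `H¹(D_v, M) = H¹(⊤ ⊓ D_v, M)`. A definition; nothing asserted.
[cite: GreenbergLNM1716, §2] -/
def inflDecomp (v : HeightOneSpectrum (𝓞 K)) :
    subgroupH1 (decomp (K := K) v) M →+ galoisCohomology ((ofSMul M hM).toLocal (Sum.inr v)) 1 :=
  (inflToCompletion hM v).comp
    (resOfLe M (inf_le_right : (⊤ : Subgroup (absoluteGaloisGroup K)) ⊓ decomp v ≤ decomp v))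

/-- `inflDecomp` is injective. [cite: GreenbergLNM1716, §2] -/
theorem inflDecomp_injective (v : HeightOneSpectrum (𝓞 K)) : Injective (inflDecomp hM v) :=
  (inflToCompletion_injective hM v).comp
    (resOfLe_injective_of_ge M inf_le_right (decomp_le_top_inf v))

/-- **`inflDecomp (res_{D_v} c) = loc_v c`** for `c ∈ H¹(K, M)`. [cite: GreenbergLNM1716, §2] -/
theorem inflDecomp_resSubgroup (v : HeightOneSpectrum (𝓞 K))
    (c : galoisCohomology (ofSMul M hM) 1) :
    inflDecomp hM v (ResKernel.resSubgroup (decomp v) M (toDiscreteH1 hM c)) =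
      galoisCohomology.localization (ofSMul M hM) (Sum.inr v) 1 c := by
  rw [inflDecomp, AddMonoidHom.comp_apply, ← inflToCompletion_resOfLe_topEquivH1 hM v c,
    topEquivH1_apply]
  have e : (resOfLe M
      (inf_le_right : (⊤ : Subgroup (absoluteGaloisGroup K)) ⊓ decomp v ≤ decomp v)).comp
      (ResKernel.resSubgroup (decomp v) M) =
      (resOfLe M (inf_le_left : (⊤ : Subgroup (absoluteGaloisGroup K)) ⊓ decomp v ≤ ⊤)).comp
        (resH1Hom (Literature.NumberTheory.EllipticCurves.subgroupIncl
          (⊤ : Subgroup (absoluteGaloisGroup K))) (AddMonoidHom.id M) fun _ _ ↦ rfl) := by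
    rw [resOfLe, resOfLe, ResKernel.resSubgroup, resH1Hom_comp, resH1Hom_comp]
    exact resH1Hom_congr (ContinuousMonoidHom.ext fun _ ↦ rfl) (AddMonoidHom.ext fun _ ↦ rfl) _ _
  exact congrArg (fun f ↦ inflToCompletion hM v (f (toDiscreteH1 hM c))) e

/-- `loc_v c = 0 ⟹ res_{D_v} c = 0` (gen 11's `localization_inr_eq_zero_iff`).
[cite: GreenbergLNM1716, §2] -/
theorem resSubgroup_decomp_eq_zero_of_localization_eq_zero (v : HeightOneSpectrum (𝓞 K))
    (c : galoisCohomology (ofSMul M hM) 1)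
    (hc : galoisCohomology.localization (ofSMul M hM) (Sum.inr v) 1 c = 0) :
    ResKernel.resSubgroup (decomp v) M (toDiscreteH1 hM c) = 0 :=
  (localization_inr_eq_zero_iff hM v c).1 hc

/-- `loc_v c = inflDecomp z ⟹ res_{D_v} c = z`. [cite: GreenbergLNM1716, §2] -/
theorem resSubgroup_decomp_eq_of_localization_eq (v : HeightOneSpectrum (𝓞 K))
    (c : galoisCohomology (ofSMul M hM) 1) (z : subgroupH1 (decomp (K := K) v) M)
    (hc : galoisCohomology.localization (ofSMul M hM) (Sum.inr v) 1 c = inflDecomp hM v z) :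
    ResKernel.resSubgroup (decomp v) M (toDiscreteH1 hM c) = z :=
  inflDecomp_injective hM v (by rw [inflDecomp_resSubgroup, hc])

end Local

end Summit.BirchSwinnertonDyer.Rank1Residual.X11b.Coinv

end
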